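import Literature.AlgebraicGeometry.Resolution.HasseSchmidtChartPurity
import Mathlib.LinearAlgebra.Matrix.Determinant.Basic
import HarnessLib

/-!
# Independence of the root linear forms is an OPEN condition read off the pure Hasse–Schmidt coefficients

Topic: `Literature/AlgebraicGeometry/Resolution`. Companion of `HasseSchmidtChartPurity.lean`. There, at a maximal
ideal `𝔭` of an étale chart `A` (over a perfect field `K` of exponential characteristic `p`) a section `g_i ∈ 𝔭^{q_i}`,
`q_i = p^{e_i}`, whose degree-`q_i` initial form is pure has the initial form `(Σ_m ā_{i,m} ū_m)^{q_i}` with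
`ā_{i,m}^{q_i} = (D^{[q_i e_m]} g_i)‾` — the ROOT LINEAR FORM `ℓ_i = Σ_m ā_{i,m} ū_m` has as coefficients the `q_i`-th
roots of the residues of the GLOBAL functions `c_{i,m} = hsComponent T_A (q_i • e_m) g_i ∈ A`. PROVED here:

* `Matrix.det_of_pow_expChar_pow` — over a commutative ring of exponential characteristic `p`,
  `det (B_{ij}^{p^E}) = (det B)^{p^E}` (the iterated Frobenius is a ring homomorphism);
* `isUnit_det_iff_det_pow_not_mem` — **root independence is read off global functions**: `O = A_𝔭` (`𝔭` maximal,
  `K → A → O`), matrices `a ∈ M_r(O)`, `c ∈ M_r(A)` with `ā_{ij}^{p^{e_i}} = c̄_{ij}` in the residue field, and `E ≥ e_i`: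
  `det a` is a unit of `O` (i.e. the rows `ā_i` are linearly independent over the residue field on these columns)
  `⟺ det (c_{ij}^{p^{E − e_i}}) ∉ 𝔭`. The right-hand side is the non-vanishing at `𝔭` of ONE element of `A`; as `𝔭`
  varies over the maximal spectrum this is an OPEN condition.

Bearing (nothing of it asserted): step (iv) of the discharge route for GAP-LEDGER row R20 (Th. 6.14 (1) of H. Hironaka's
2017 manuscript; campaign `res-hironaka`, lead README §2): «for an `r×r` minor of `B = (ℓ`-coefficients`)`,
`(minor)^{q_r} = Σ_σ ± ∏_i (D^{(q_i e_σ(i))} g_i′)(η)^{q_r/q_i}` is a regular function of `η` ⇒ independence is OPEN»;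
the determinant identity is the lead's kernel `Campaign.R20.det_pow_rows` (HOME/ledger/evidence/R20/res-adj-3-R20Model.lean,
adapted here), the rest is the bookkeeping through the residue field of `A_𝔭`.

Sources: [Matsumura1987] §27, §30; [EGAIV4] Thm. 16.11.2; [VillamayorU2008ReesDiff] §4.1, Remark 4.3.
-/

noncomputable section

namespace Literature.AlgebraicGeometry.Resolution

open Finsupp IsLocalRing MvPowerSeries

universe u v w

/-! ## Frobenius commutes with determinants -/

section Det

variable {R : Type v} [CommRing R] (p : ℕ) [ExpChar R p] {n : Type*} [Fintype n] [DecidableEq n]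

/-- **`det (B_{ij}^{p^E}) = (det B)^{p^E}`** over a commutative ring of exponential characteristic `p`: the iterated
Frobenius `x ↦ x^{p^E}` is a ring homomorphism, and ring homomorphisms commute with determinants (Mathlib
`RingHom.map_det`). (Adapted from the campaign kernel `Campaign.R20.det_pow_rows` of res-adj-3.)
[cite: Matsumura1987, §30 (the Frobenius endomorphism in characteristic `p`)] -/
theorem Matrix.det_of_pow_expChar_pow (E : ℕ) (B : Matrix n n R) :
    (Matrix.of fun i j => B i j ^ p ^ E).det = B.det ^ p ^ E := by
  have h := RingHom.map_det (iterateFrobenius R p E) B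
  rw [iterateFrobenius_def] at h
  rw [h, RingHom.mapMatrix_apply]
  congr 1

end Det

/-! ## Root independence at a maximal ideal, read off global functions -/

section Roots

variable (K : Type u) [Field K] {A : Type w} [CommRing A] [Algebra K A]

/-- **Independence of the roots is detected by a global function.** `K` a field of exponential characteristic `p`,
`A` a `K`-algebra, `𝔭 ⊂ A` maximal, `O = A_𝔭` (with `K → A → O`); `a ∈ M_r(O)` and `c ∈ M_r(A)` with
`ā_{ij}^{p^{e_i}} = (c_{ij}/1)‾` in the residue field of `O` (row `i` of `a` = `p^{e_i}`-th roots of the residues of row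
`i` of `c`), and `E ≥ e_i` for all `i`. Then `det a` is a unit of `O` iff `det (c_{ij}^{p^{E−e_i}}) ∉ 𝔭`: raising
`det ā` to the `p^E`-th power (injective on the residue field) turns it into the residue of the GLOBAL element
`det (c_{ij}^{p^{E−e_i}}) ∈ A`. [cite: Matsumura1987, §30 (Frobenius in characteristic `p`)]
[cite: VillamayorU2008ReesDiff, §4.1 and Remark 4.3] -/
theorem isUnit_det_iff_det_pow_not_mem (p : ℕ) [ExpChar K p] (𝔭 : Ideal A) [𝔭.IsMaximal] (O : Type*)
    [CommRing O] [IsLocalRing O] [Algebra A O] [IsLocalization.AtPrime O 𝔭] [Algebra K O] [IsScalarTower K A O]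
    {r : ℕ} (e : Fin r → ℕ) (E : ℕ) (hE : ∀ i, e i ≤ E) (a : Matrix (Fin r) (Fin r) O)
    (c : Matrix (Fin r) (Fin r) A)
    (ha : ∀ i j, residue O (a i j) ^ p ^ e i = residue O (algebraMap A O (c i j))) :
    IsUnit a.det ↔ (Matrix.of fun i j => c i j ^ p ^ (E - e i)).det ∉ 𝔭 := by
  -- the residue field has exponential characteristic `p`
  haveI : ExpChar (ResidueField O) p :=
    expChar_of_injective_ringHom ((residue O).comp (algebraMap K O)).injective p
  -- `det a` is a unit iff its residue is non-zero iff the `p^E`-th power of its residue is non-zero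
  rw [← residue_ne_zero_iff_isUnit, ← pow_ne_zero_iff (pow_ne_zero E (expChar_pos (ResidueField O) p).ne'),
    RingHom.map_det, ← Matrix.det_of_pow_expChar_pow p E]
  -- entrywise: `(ā_{ij})^{p^E} = ((c_{ij}^{p^{E - e_i}})/1)‾`
  have hentry : (Matrix.of fun i j => ((residue O).mapMatrix a) i j ^ p ^ E) =
      ((residue O).comp (algebraMap A O)).mapMatrix (Matrix.of fun i j => c i j ^ p ^ (E - e i)) := by
    ext i j
    simp only [Matrix.of_apply, RingHom.mapMatrix_apply, Matrix.map_apply, RingHom.comp_apply, map_pow]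
    rw [← ha i j, ← pow_mul, ← pow_add, Nat.add_sub_cancel' (hE i)]
  rw [hentry, ← RingHom.map_det, RingHom.comp_apply, Ne, residue_eq_zero_iff,
    IsLocalization.AtPrime.to_map_mem_maximal_iff O 𝔭]

end Roots

end Literature.AlgebraicGeometry.Resolution

end
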